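import Summits.QuantumFields.BalabanUV.Beta.EriceFlowEnclosureB12AsPrintedHistoryContagionShiftFlowPicardPin
import Summits.QuantumFields.BalabanUV.Beta.EriceFlowEnclosureB12AsPrintedHistoryContagionShiftFlowEnd

/-!
# Beta / EriceFlowEnclosureB12AsPrintedHistoryContagionShiftFlowPicardEnd — ASYMPTOTIC FREEDOM IS CONTAGIOUS, part 15 (the lattice-free END): on the as-printed
# carrier, [I] THEOREM 2 AS TYPED + the binder `hrg` + NE4 + coupling-chart fading memory (θ < 1) on a box of ANY size ⟹ for every torus exponent m there is g₉ > 0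
# such that at EVERY renormalized coupling g ∈ ]0, g₉]: node U2's LATTICE-FREE Picard scheme for the renormalization group equation of the limit theory — `iterate
# (betaInf S.β) g n` from the constant history, `solution (betaInf S.β) g` its scale-wise limit (`T4BetaFlowWellPosed` §4) — CONVERGES, its limit is THE unique box
# solution of `MemFlow (betaInf S.β) g ·`, and it EQUALS the continuum running coupling `gstar` of EVERY family of Theorem-2-type rows pinned at g (part 6), at the
# geometric rate 2^{−n}: **THE CONTINUUM RUNNING COUPLING OF THEOREM 2 IS CONSTRUCTED WITHOUT ANY LATTICE FAMILY** — node U2's `gstar_eq_solution ∕ tendsto_iterate ∕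
# abs_iterate_sub_solution_le` with NO asymptotic-freedom letter, NO floor, NO `C_m γ < b(1−θ)` (β-flow team, prover 1, unit `b2b-balaban-beta-bflow-p1`, gen 37; ROW
# AP-I·Uc × NODE U2; parts 12–14 `…ShiftFlowPicard ∕ PicardLimit ∕ PicardPin` = the abstract lattice-free iteration)

HONEST FRAMING (page 1 of everything the β sub-cell writes): discharging `BetaPertH` makes Bałaban's UV stability UNCONDITIONAL — a
real constructive-QFT result; it is NOT the continuum limit and NOT the Clay problem.  HONEST DEPENDENCY (cell reorg 2026-08-19,
verbatim): «continuum YM on T⁴ ⇐ BetaPertH ∧ nine spine estimates (0/9 proved); BetaPertH ⇐ (D1) ∧ (D4) ∧ CAP+tail; G-an2-4 gates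
asym, D1 and NE2/3/4.»  THIS MODULE DISCHARGES NOTHING: a junction BY NAME of parts 13 ∕ 14 (`memFlow_solution_of_reference`, `eq_solution_of_memFlow_of_reference`,
`abs_picardIter_sub_solution_le`, `iterate_eq_picardIter`, `sep_twoSided_of_reference_flow`) with part 6 (`memFlow_bigBox_of_typedTheorem2`, `continuumCoupling_bigBox_of_typedTheorem2`,
`continuumCoupling_of_typedTheorem2`), part 11 (`flow_threshold_exists`) and node U2's `T4BetaStationary.memoryProfile_betaInf` ∕ `T4ContinuumCoupling.one_div_gstar_sq`, over
the NAMED FIELDS of `B12BetaAsPrinted` ([I] = T. Bałaban, Commun. Math. Phys. **109** (1987) [Balaban1987RG1]): `Theorem2Statement S hL` (Theorem 2 AS TYPED — STATED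
WITHOUT PROOF in print, p. 259; a HYPOTHESIS), the binder `hrg` ((0.20) along in-box rows).  The LETTERS `ScaleShiftRate` (NE4; NOT PRINTED, GAPS G-t4-U2-1) and
`HistLipschitz` ∕ `FadingMemory` (NOT PRINTED, GAPS G-t4-U2-2) are hypotheses on the abstract family `S.β`; NOTHING is asserted about Bałaban's β.  «Continuum running
coupling» = the K → ∞ limit of the effective couplings of (0.20) at fixed physical scale (`T4ContinuumCoupling.gstar`), NOT the continuum limit of the measures.

WHAT THIS FILE PROVES (0 sorry, 0 def): **`solution_eq_gstar_of_typedTheorem2`** (∀ m ∃ g₉ > 0 ∀ g ∈ ]0, g₉]: node U2's `solution (betaInf S.β) g` is a box solution of the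
limit RG equation, the scale-wise limit of node U2's `iterate (betaInf S.β) g`; EVERY box solution at g is it; Theorem 2's tuned rows exist at g and the continuum running
coupling of EVERY family of Theorem-2-type rows pinned at g EQUALS it; and `|iterate (betaInf S.β) g (n+1) m′ − solution (betaInf S.β) g m′| ≤ (32Cγ_u g³∕(1−θ)²)(2∕(1+θ))^{m′}
2^{−n}`), **`gstar_picard_rate_of_typedTheorem2`** (the lattice-free iterates converge to Theorem 2's continuum running coupling at rate 2^{−n}), **`solution_twoPin_of_typedTheorem2`**
(part 14's two-pin law for node U2's `solution` on the carrier: `(2∕3)(1∕g² − 1∕g′²) ≤ 1∕solution_g(m′)² − 1∕solution_{g′}(m′)² ≤ (4∕3)(1∕g² − 1∕g′²)`, strictly increasing and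
`|solution_g − solution_{g′}| ≤ (64∕3)(g′ − g)` uniformly in the scale).  NOT CLAIMED: anything about Bałaban's β; Theorem 2; `BetaPertH`; the continuum limit of the measures; Clay.
-/

namespace Summit.QuantumFields.BalabanUV.Beta.EriceFlowEnclosureB12AsPrintedHistoryContagionShiftFlowPicardEnd

open Finset Filter Topology
open Literature.MathematicalPhysics.QuantumFieldTheory.Balaban1983to89
open Literature.MathematicalPhysics.QuantumFieldTheory.Balaban1983to89.B12BetaAsPrinted
open Literature.MathematicalPhysics.QuantumFieldTheory.Balaban1983to89.FlowStep (RGEqH)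
open Literature.MathematicalPhysics.QuantumFieldTheory.Balaban1983to89.T4CouplingMatching (HistLipschitz FadingMemory ScaleShiftRate disc)
open Literature.MathematicalPhysics.QuantumFieldTheory.Balaban1983to89.T4CauchySum (InjectedRate)
open Literature.MathematicalPhysics.QuantumFieldTheory.Balaban1983to89.T4ContinuumCoupling (astar gstar)
open Literature.MathematicalPhysics.QuantumFieldTheory.Balaban1983to89.T4BetaStationary (SeqBox betaInf memoryProfile_betaInf)
open Literature.MathematicalPhysics.QuantumFieldTheory.Balaban1983to89.T4BetaFlowWellPosed (MemFlow iterate solution picard)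
open Summit.QuantumFields.BalabanUV.Beta.EriceFlowEnclosureB12AsPrintedHistoryContagionShiftEnd (continuumCoupling_bigBox_of_typedTheorem2
  memFlow_bigBox_of_typedTheorem2 continuumCoupling_of_typedTheorem2)
open Summit.QuantumFields.BalabanUV.Beta.EriceFlowEnclosureB12AsPrintedHistoryContagionShiftFlowEnd (flow_threshold_exists)
open Summit.QuantumFields.BalabanUV.Beta.EriceFlowEnclosureB12AsPrintedHistoryContagionShiftFlowPicardLimit (memFlow_solution_of_reference
  eq_solution_of_memFlow_of_reference abs_picardIter_sub_solution_le iterate_eq_picardIter)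
open Summit.QuantumFields.BalabanUV.Beta.EriceFlowEnclosureB12AsPrintedHistoryContagionShiftFlowPicardPin (sep_twoSided_of_reference_flow lt_of_pin_lt
  abs_sub_le_of_pins)

noncomputable section

variable {S : Setting}

/-- THE AS-PRINTED REFERENCE: from `Theorem2Statement` AS TYPED (+ `hrg`, NE4, moduli) — ONE box solution t of `MemFlow (betaInf S.β) g_r t` with an AF profile
`1∕(2g_r)² + b·m′ ≤ 1∕t(m′)²` (the continuum running coupling of Theorem 2's rows at one fixed coupling g_r, parts 6 ∕ 11), the memory profile `MemoryProfile C θ γ_u (betaInf S.β)`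
being node U2's `memoryProfile_betaInf`; plus the thresholds g₂ (part 6's `memFlow_bigBox`) and g₃ (Theorem 2's rows exist). [cite: Balaban1987RG1, Thm 2 (0.31) p.259 with (0.20) p.256 and §5 p.298] -/
theorem reference_of_typedTheorem2 {hL : Odd S.L ∧ 1 < S.L} (h : Theorem2Statement S hL)
    {γu θ C c : ℝ} {Λ : ℕ → ℕ → ℝ} (hγu : 0 < γu)
    (hrg : ∀ P : B12.RunParams, Step.InInterval γu P.K (S.cpl P) → RGEqH P.K S.β (S.cpl P))
    (hS : ScaleShiftRate c θ γu S.β) (hL' : HistLipschitz Λ γu S.β) (hΛ : FadingMemory C θ Λ)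
    (hθ0 : 0 < θ) (hθ1 : θ < 1) (hC : 0 ≤ C) (hc : 0 ≤ c) (m : ℕ) :
    ∃ (gr b g₂ g₃ : ℝ) (t : ℕ → ℝ), 0 < gr ∧ 0 < b ∧ 0 < g₂ ∧ 0 < g₃ ∧ SeqBox γu t ∧ MemFlow (betaInf S.β) gr t ∧
      (∀ m' : ℕ, 1 / (2 * gr) ^ 2 + b * (m' : ℝ) ≤ 1 / (t m') ^ 2) ∧
      (∀ (g : ℕ → ℕ → ℝ) (gIR : ℝ), (∀ K, ∃ (m' : ℕ) (g₀ : ℝ), g K = S.cpl ⟨K, m', g₀⟩) → (∀ K, Step.InInterval γu K (g K)) →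
        (∀ K, g K K = gIR) → gIR ≤ g₂ → SeqBox γu (gstar g) ∧ MemFlow (betaInf S.β) gIR (gstar g)) ∧
      (∀ gIR : ℝ, 0 < gIR → gIR ≤ g₃ → ∃ g₀ : ℕ → ℝ, (∀ K, Step.InInterval γu K (S.cpl ⟨K, m, g₀ K⟩)) ∧ (∀ K, S.cpl ⟨K, m, g₀ K⟩ K = gIR)) := by
  obtain ⟨g₂, hg₂, hmem⟩ := memFlow_bigBox_of_typedTheorem2 h hγu hrg hS hL' hΛ hθ0 hθ1 hC hc m
  obtain ⟨g₂', b, b', hg₂', hb, -, hall⟩ := continuumCoupling_bigBox_of_typedTheorem2 h hγu hrg hS hL' hΛ hθ0 hθ1 hC hc m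
  obtain ⟨g₃, b₃, b₃', hg₃, -, -, hex⟩ := continuumCoupling_of_typedTheorem2 h hγu hrg hS hL' hΛ hθ0 hθ1 hC hc m
  set gr : ℝ := min g₃ (min g₂ g₂') with hgr
  have hgr0 : 0 < gr := lt_min hg₃ (lt_min hg₂ hg₂')
  obtain ⟨g₀r, hIr, hendr, -⟩ := hex gr hgr0 (min_le_left _ _)
  have hrowr : ∀ K, ∃ (m' : ℕ) (g₀ : ℝ), (fun K => S.cpl ⟨K, m, g₀r K⟩) K = S.cpl ⟨K, m', g₀⟩ := fun K => ⟨m, g₀r K, rfl⟩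
  obtain ⟨-, htbox, htflow⟩ := hmem (fun K => S.cpl ⟨K, m, g₀r K⟩) gr hrowr hIr hendr ((min_le_right _ _).trans (min_le_left _ _))
  obtain ⟨hinjr, -, -, -, -, -, -, hprofr, -⟩ :=
    hall (fun K => S.cpl ⟨K, m, g₀r K⟩) gr hrowr hIr hendr ((min_le_right _ _).trans (min_le_right _ _))
  have hboxr : ∀ K i, i ≤ K → 0 < S.cpl ⟨K, m, g₀r K⟩ i ∧ S.cpl ⟨K, m, g₀r K⟩ i ≤ γu := fun K => hIr K
  have hprof : ∀ m' : ℕ, 1 / (2 * gr) ^ 2 + b * (m' : ℝ) ≤ 1 / (gstar (fun K => S.cpl ⟨K, m, g₀r K⟩) m') ^ 2 := by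
    intro m'
    rw [T4ContinuumCoupling.one_div_gstar_sq hθ1 hinjr hboxr m']
    have e1 : 1 / (2 * gr) ^ 2 = 1 / (4 * gr ^ 2) := by ring
    rw [e1]
    exact (hprofr m').1
  refine ⟨gr, b, g₂, g₃, gstar (fun K => S.cpl ⟨K, m, g₀r K⟩), hgr0, hb, hg₂, hg₃, htbox, htflow, hprof, ?_, ?_⟩
  · intro g gIR hrow hI hpin hle
    obtain ⟨-, hbox, hflow⟩ := hmem g gIR hrow hI hpin hle
    exact ⟨hbox, hflow⟩
  · intro gIR hgIR hle
    obtain ⟨g₀, hI, hend, -⟩ := hex gIR hgIR hle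
    exact ⟨g₀, hI, hend⟩

/-- **NODE U2's LATTICE-FREE SOLUTION IS THEOREM 2's CONTINUUM RUNNING COUPLING — FROM THEOREM 2 AS TYPED.**  `Theorem2Statement S hL` (a HYPOTHESIS), the binder `hrg`
on ]0, γ_u], NE4 `ScaleShiftRate c θ γ_u S.β` (c ≥ 0), `HistLipschitz Λ γ_u S.β` with `FadingMemory C θ Λ` (0 < θ < 1, C ≥ 0; γ_u ARBITRARY against (C, θ)) ⟹ for every
torus exponent m there is g₉ > 0 such that for EVERY g ∈ ]0, g₉]: (i) node U2's `solution (betaInf S.β) g` — the scale-wise limit of the Picard iterates `iterate (betaInf S.β) g n`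
from the constant history g, NO lattice family involved — is box-valued in ]0, γ_u], solves `MemFlow (betaInf S.β) g ·` and IS that limit (part 13); (ii) EVERY box-valued
solution of `MemFlow (betaInf S.β) g ·` equals it; (iii) Theorem 2's tuned rows «g₀(ε, g)» exist at g, and the continuum running coupling `gstar` of EVERY family of
Theorem-2-type rows in ]0, γ_u] pinned at g (part 6) EQUALS `solution (betaInf S.β) g`; (iv) the rate: `|iterate (betaInf S.β) g (n+1) m′ − solution (betaInf S.β) g m′| ≤
(32Cγ_u g³∕(1 − θ)²)·(2∕(1+θ))^{m′}·2^{−n}`.  Node U2's `gstar_eq_solution ∕ tendsto_iterate ∕ abs_iterate_sub_solution_le` (from the AF floor `EventualLowerH b` + `C_m γ < b(1 − θ)`)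
with NEITHER assumed. [cite: Balaban1987RG1, Thm 2 (0.31) p.259 with (0.20) p.256 and §5 p.298] -/
theorem solution_eq_gstar_of_typedTheorem2 {hL : Odd S.L ∧ 1 < S.L} (h : Theorem2Statement S hL)
    {γu θ C c : ℝ} {Λ : ℕ → ℕ → ℝ} (hγu : 0 < γu)
    (hrg : ∀ P : B12.RunParams, Step.InInterval γu P.K (S.cpl P) → RGEqH P.K S.β (S.cpl P))
    (hS : ScaleShiftRate c θ γu S.β) (hL' : HistLipschitz Λ γu S.β) (hΛ : FadingMemory C θ Λ)
    (hθ0 : 0 < θ) (hθ1 : θ < 1) (hC : 0 ≤ C) (hc : 0 ≤ c) (m : ℕ) :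
    ∃ g₉ : ℝ, 0 < g₉ ∧ ∀ e : ℝ, 0 < e → e ≤ g₉ →
      (SeqBox γu (solution (betaInf S.β) e) ∧ MemFlow (betaInf S.β) e (solution (betaInf S.β) e) ∧
        ∀ m', Tendsto (fun n => iterate (betaInf S.β) e n m') atTop (𝓝 (solution (betaInf S.β) e m'))) ∧
      (∀ h' : ℕ → ℝ, SeqBox γu h' → MemFlow (betaInf S.β) e h' → h' = solution (betaInf S.β) e) ∧
      (∃ g₀ : ℕ → ℝ, (∀ K, Step.InInterval γu K (S.cpl ⟨K, m, g₀ K⟩)) ∧ (∀ K, S.cpl ⟨K, m, g₀ K⟩ K = e)) ∧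
      (∀ g : ℕ → ℕ → ℝ, (∀ K, ∃ (m' : ℕ) (g₀ : ℝ), g K = S.cpl ⟨K, m', g₀⟩) → (∀ K, Step.InInterval γu K (g K)) →
        (∀ K, g K K = e) → gstar g = solution (betaInf S.β) e) ∧
      (∀ n m' : ℕ, |iterate (betaInf S.β) e (n + 1) m' - solution (betaInf S.β) e m'|
        ≤ 32 * C * γu * e ^ 3 / (1 - θ) ^ 2 / ((1 + θ) / 2) ^ m' * (1 / 2) ^ n) := by
  have h1θ : 0 < 1 - θ := by linarith
  have hB := memoryProfile_betaInf hS hL' hΛ hθ0.le hθ1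
  obtain ⟨gr, b, g₂, g₃, t, hgr, hb, hg₂, hg₃, htbox, htflow, hprof, hmem, hex⟩ :=
    reference_of_typedTheorem2 h hγu hrg hS hL' hΛ hθ0 hθ1 hC hc m
  have h2gr : 0 < 2 * gr := by positivity
  obtain ⟨e₀, he₀, hthr⟩ := flow_threshold_exists (1 / gr ^ 2 + C * γu / (1 - θ) ^ 2 + (2 * C / ((1 - θ) * b)) ^ 2) hC hθ1 hb
  refine ⟨min e₀ (min (γu / 2) (min g₂ g₃)), lt_min he₀ (lt_min (by positivity) (lt_min hg₂ hg₃)), fun e he hle => ?_⟩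
  obtain ⟨hs1, hs2, hs4⟩ := hthr e he (hle.trans (min_le_left _ _))
  have h2e : 2 * e ≤ γu := by linarith [hle.trans ((min_le_right _ _).trans (min_le_left _ _))]
  have hle2 : e ≤ g₂ := hle.trans ((min_le_right _ _).trans ((min_le_right _ _).trans (min_le_left _ _)))
  have hle3 : e ≤ g₃ := hle.trans ((min_le_right _ _).trans ((min_le_right _ _).trans (min_le_right _ _)))
  obtain ⟨hss, hsf, -, hlim⟩ := memFlow_solution_of_reference hB hC hθ0.le hθ1 hb h2gr htbox htflow hprof he h2e hs1 hs2 hs4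
  have huniq : ∀ h' : ℕ → ℝ, SeqBox γu h' → MemFlow (betaInf S.β) e h' → h' = solution (betaInf S.β) e := fun h' hh' hf' =>
    eq_solution_of_memFlow_of_reference hB hC hθ0.le hθ1 hb h2gr htbox htflow hprof he h2e hs1 hs2 hs4 hh' hf'
  refine ⟨⟨hss, hsf, hlim⟩, huniq, hex e he hle3, fun g hrow hI hpin => ?_, fun n m' => ?_⟩
  · obtain ⟨hbox, hflow⟩ := hmem g e hrow hI hpin hle2
    exact huniq _ hbox hflow
  · have hus : SeqBox γu (fun _ : ℕ => e) := fun _ => ⟨he, by linarith⟩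
    have henv : ∀ q : ℕ, (fun _ : ℕ => e) q ≤ 2 * e := fun _ => by simp only; linarith
    have hr := abs_picardIter_sub_solution_le hB hC hθ0.le hθ1 hb h2gr htbox htflow hprof he h2e hus henv hs1 hs2 hs4 m' n
    rwa [← iterate_eq_picardIter] at hr

/-- **THE LATTICE-FREE ITERATES CONVERGE TO THEOREM 2's CONTINUUM RUNNING COUPLING AT RATE 2^{−n}.**  Under the data of `solution_eq_gstar_of_typedTheorem2`, for every m there is
g₉ > 0 such that for every g ∈ ]0, g₉] and EVERY family of Theorem-2-type rows in ]0, γ_u] pinned at g: `|iterate (betaInf S.β) g (n+1) m′ − gstar rows m′| ≤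
(32Cγ_u g³∕(1 − θ)²)·(2∕(1+θ))^{m′}·2^{−n}` and `iterate (betaInf S.β) g n m′ → gstar rows m′` — the continuum running coupling of [I] Theorem 2's «g₀(ε, g)», at every physical
scale, is COMPUTED by node U2's Picard iteration from the constant history, with no lattice family entering the computation. [cite: Balaban1987RG1, Thm 2 (0.31) p.259 with (0.20) p.256 and §5 p.298] -/
theorem gstar_picard_rate_of_typedTheorem2 {hL : Odd S.L ∧ 1 < S.L} (h : Theorem2Statement S hL)
    {γu θ C c : ℝ} {Λ : ℕ → ℕ → ℝ} (hγu : 0 < γu)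
    (hrg : ∀ P : B12.RunParams, Step.InInterval γu P.K (S.cpl P) → RGEqH P.K S.β (S.cpl P))
    (hS : ScaleShiftRate c θ γu S.β) (hL' : HistLipschitz Λ γu S.β) (hΛ : FadingMemory C θ Λ)
    (hθ0 : 0 < θ) (hθ1 : θ < 1) (hC : 0 ≤ C) (hc : 0 ≤ c) (m : ℕ) :
    ∃ g₉ : ℝ, 0 < g₉ ∧ ∀ (e : ℝ) (g : ℕ → ℕ → ℝ), 0 < e → e ≤ g₉ →
      (∀ K, ∃ (m' : ℕ) (g₀ : ℝ), g K = S.cpl ⟨K, m', g₀⟩) → (∀ K, Step.InInterval γu K (g K)) → (∀ K, g K K = e) →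
      (∀ n m' : ℕ, |iterate (betaInf S.β) e (n + 1) m' - gstar g m'| ≤ 32 * C * γu * e ^ 3 / (1 - θ) ^ 2 / ((1 + θ) / 2) ^ m' * (1 / 2) ^ n) ∧
      ∀ m', Tendsto (fun n => iterate (betaInf S.β) e n m') atTop (𝓝 (gstar g m')) := by
  obtain ⟨g₉, hg₉, hmain⟩ := solution_eq_gstar_of_typedTheorem2 h hγu hrg hS hL' hΛ hθ0 hθ1 hC hc m
  refine ⟨g₉, hg₉, fun e g he hle hrow hI hpin => ?_⟩
  obtain ⟨⟨-, -, hlim⟩, -, -, hgs, hrate⟩ := hmain e he hle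
  rw [hgs g hrow hI hpin]
  exact ⟨hrate, hlim⟩

/-- **THE TWO-PIN LAW FOR node U2's LATTICE-FREE SOLUTIONS ON THE CARRIER** (part 14 read at Theorem 2 AS TYPED): for every m there is g₁₀ > 0 such that for all
0 < g ≤ g′ ≤ g₁₀ the box solutions `solution (betaInf S.β) g`, `solution (betaInf S.β) g′` satisfy at EVERY physical scale m′
`(2∕3)(1∕g² − 1∕g′²) ≤ 1∕solution_g(m′)² − 1∕solution_{g′}(m′)² ≤ (4∕3)(1∕g² − 1∕g′²)`, `solution_g(m′) < solution_{g′}(m′)` if g < g′, and `|solution_g(m′) − solution_{g′}(m′)| ≤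
(64∕3)(g′ − g)` — strictly increasing, Lipschitz and co-Lipschitz in the renormalized coupling, uniformly in the scale, DIRECTLY (no `eq_gstar`, no lattice family).
[cite: Balaban1987RG1, Thm 2 (0.31) p.259 with (0.20) p.256 and §5 p.298] -/
theorem solution_twoPin_of_typedTheorem2 {hL : Odd S.L ∧ 1 < S.L} (h : Theorem2Statement S hL)
    {γu θ C c : ℝ} {Λ : ℕ → ℕ → ℝ} (hγu : 0 < γu)
    (hrg : ∀ P : B12.RunParams, Step.InInterval γu P.K (S.cpl P) → RGEqH P.K S.β (S.cpl P))
    (hS : ScaleShiftRate c θ γu S.β) (hL' : HistLipschitz Λ γu S.β) (hΛ : FadingMemory C θ Λ)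
    (hθ0 : 0 < θ) (hθ1 : θ < 1) (hC : 0 ≤ C) (hc : 0 ≤ c) (m : ℕ) :
    ∃ g₁₀ : ℝ, 0 < g₁₀ ∧ ∀ e e' : ℝ, 0 < e → e ≤ e' → e' ≤ g₁₀ →
      (∀ m', 2 / 3 * (1 / e ^ 2 - 1 / e' ^ 2) ≤ 1 / (solution (betaInf S.β) e m') ^ 2 - 1 / (solution (betaInf S.β) e' m') ^ 2 ∧
        1 / (solution (betaInf S.β) e m') ^ 2 - 1 / (solution (betaInf S.β) e' m') ^ 2 ≤ 4 / 3 * (1 / e ^ 2 - 1 / e' ^ 2)) ∧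
      (e < e' → ∀ m', solution (betaInf S.β) e m' < solution (betaInf S.β) e' m') ∧
      (∀ m', |solution (betaInf S.β) e m' - solution (betaInf S.β) e' m'| ≤ 64 / 3 * (e' - e)) := by
  have h1θ : 0 < 1 - θ := by linarith
  have hB := memoryProfile_betaInf hS hL' hΛ hθ0.le hθ1
  obtain ⟨gr, b, g₂, g₃, t, hgr, hb, -, -, htbox, htflow, hprof, -, -⟩ :=
    reference_of_typedTheorem2 h hγu hrg hS hL' hΛ hθ0 hθ1 hC hc m
  have h2gr : 0 < 2 * gr := by positivity
  obtain ⟨e₀, he₀, hthr⟩ := flow_threshold_exists (1 / gr ^ 2 + C * γu / (1 - θ) ^ 2 + (2 * C / ((1 - θ) * b)) ^ 2) hC hθ1 hb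
  -- the extra smallness `C(8e³ + 16e∕b) ≤ (1−θ)∕4` below e₁
  set e₁ : ℝ := min 1 ((1 - θ) / (4 * (C * (8 + 16 / b)) + 1)) with he₁
  have he₁0 : 0 < e₁ := lt_min one_pos (by positivity)
  have hs5 : ∀ e : ℝ, 0 < e → e ≤ e₁ → C * (8 * e ^ 3 + 16 * e / b) ≤ (1 - θ) / 4 := by
    intro e he hle
    have hle1 : e ≤ 1 := hle.trans (min_le_left _ _)
    have hle' : e ≤ (1 - θ) / (4 * (C * (8 + 16 / b)) + 1) := hle.trans (min_le_right _ _)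
    rw [le_div_iff₀ (by positivity)] at hle'
    have he3 : e ^ 3 ≤ e := by nlinarith [mul_le_mul hle1 hle1 he.le zero_le_one]
    have hK : 0 ≤ C * (8 + 16 / b) := by positivity
    calc C * (8 * e ^ 3 + 16 * e / b) ≤ C * (8 * e + 16 * e / b) := by gcongr
      _ = e * (C * (8 + 16 / b)) := by ring
      _ ≤ (1 - θ) / 4 := by nlinarith
  refine ⟨min e₀ (min (γu / 2) e₁), lt_min he₀ (lt_min (by positivity) he₁0), fun e e' he hee' hle => ?_⟩
  have he' : 0 < e' := he.trans_le hee'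
  obtain ⟨hs1, hs2, hs4⟩ := hthr e' he' (hle.trans (min_le_left _ _))
  have h2e' : 2 * e' ≤ γu := by linarith [hle.trans ((min_le_right _ _).trans (min_le_left _ _))]
  have hs5' := hs5 e' he' (hle.trans ((min_le_right _ _).trans (min_le_right _ _)))
  have h2e : 2 * e ≤ γu := by linarith
  have hQ0 : 0 ≤ 1 / gr ^ 2 + C * γu / (1 - θ) ^ 2 + (2 * C / ((1 - θ) * b)) ^ 2 := by positivity
  have hs1e : 4 * C * e ≤ b * (1 - θ) := (by nlinarith : 4 * C * e ≤ 4 * C * e').trans hs1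
  have hs2e : e ^ 2 * (1 / gr ^ 2 + C * γu / (1 - θ) ^ 2 + (2 * C / ((1 - θ) * b)) ^ 2) ≤ 3 / 4 :=
    (mul_le_mul_of_nonneg_right (pow_le_pow_left₀ he.le hee' 2) hQ0).trans hs2
  have hs4e : 64 * C * e ^ 3 ≤ (1 - θ) ^ 2 :=
    (mul_le_mul_of_nonneg_left (pow_le_pow_left₀ he.le hee' 3) (by positivity)).trans hs4
  obtain ⟨hss, hsf, -, -⟩ := memFlow_solution_of_reference hB hC hθ0.le hθ1 hb h2gr htbox htflow hprof he h2e hs1e hs2e hs4e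
  obtain ⟨hss', hsf', -, -⟩ := memFlow_solution_of_reference hB hC hθ0.le hθ1 hb h2gr htbox htflow hprof he' h2e' hs1 hs2 hs4
  refine ⟨fun m' => sep_twoSided_of_reference_flow hB hC hθ0.le hθ1 hb h2gr htbox htflow hprof he hee' h2e' hs1 hs2 hs4 hs5' hss hsf hss' hsf' m',
    fun hlt m' => lt_of_pin_lt hB hC hθ0.le hθ1 hb h2gr htbox htflow hprof he hlt h2e' hs1 hs2 hs4 hs5' hss hsf hss' hsf' m',
    fun m' => abs_sub_le_of_pins hB hC hθ0.le hθ1 hb h2gr htbox htflow hprof he hee' h2e' hs1 hs2 hs4 hs5' hss hsf hss' hsf' m'⟩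

end

end Summit.QuantumFields.BalabanUV.Beta.EriceFlowEnclosureB12AsPrintedHistoryContagionShiftFlowPicardEnd
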